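import Summits.Ventures.YMGap.RobustBall.FluxDefectRows
import Summits.Ventures.YMGap.RobustBall.TorusOneLink
import HarnessLib

/-!
# RobustBall/CentreTubeTierOne — the currency form: ONE pair `(C, c)` for ALL tori — THE RANGE-`r` TIER-1 BALL AROUND EVERY
# CENTRE-BLIND ACTION obeys the area law at `2(d−1)N|β| + K(d,r)·ε₀ < 1`

HONEST FRAMING: venture file of the cell `pub-ymgap` (track Y2 ROBUST-BALL, seat ds-4 g8).  WHAT THIS IS: the ∀-`L` packaging of
`FluxDefectRows.areaLaw_clusterDomainFR_add_twistBlind` (which needs `L > 2r + 2`): for every `N ≥ 2`, `d`, `r`, `ε₀`, `ε₁` and `β` with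
`2(d−1)N|β| + K(d,r) ε₀ < 1`, there are `C` and `c > 0` such that for EVERY torus `L`, EVERY twist-blind `W_b` (any size, any range; e.g.
adjoint / mixed fundamental–adjoint actions of any strength) and EVERY `W ∈ ClusterDomainFR ε₀ ε₁ r` (the tier-1 ball: finite range `r`,
oscillation load `≤ ε₀`; the Lipschitz radius `ε₁` is IDLE) the fundamental Wilson loops of `⟨·⟩_{β, W_b + W, L}` obey
`|⟨W_{R×T}⟩| ≤ C^{2(R+T)} e^{−c RT}` (`areaLawCentreTubeFR`; `C = max 2 e^{c (r+1)²}`, `c = −log max(2(d−1)N|β| + K ε₀, 1/2)/((2r+2)(2r+1))`;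
small tori `L ≤ 2r + 2` are absorbed into `C` since there `R, T ≤ r + 1`).  So the window-free centre-blind area law of §6(c) holds on an
OPEN NEIGHBOURHOOD OF THE WHOLE CENTRE-BLIND AFFINE SUBSPACE in the tier-1 topology — uniformly.  Currency name `AreaLawCentreTubeFR` is
this seat's (pattern of rb-theory's `AreaLawCentreTube`/`AreaLawCentreTubeW`); rb-theory may rename.  HONEST LABEL: strong-coupling lattice
inequality, centre-projected `ℤ_N` flux picture; crude counting constant `K(d,r) = ((2r+2)^d − 1) d (4r+3)^d` (qualitative cell); `β`-window
smaller than tier 1's; nonzero-`N`-ality loops only; no σ-existence claim; T15's unbounded-range loop terms outside; nothing continuum / Clay.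
-/

noncomputable section

open Finset MeasureTheory
open Literature.MathematicalPhysics.QuantumLattice (fundamentalRep)
open Literature.MathematicalPhysics.QuantumFieldTheory

namespace Summit.Ventures.YMGap.RobustBall

open ZN ZNFluxW

variable {d L N : ℕ}

/-- **`AreaLawCentreTubeFR N d β ε₀ ε₁ r`** — the area law, with ONE pair of constants, for every torus, every twist-blind `W_b` and
every member `W` of the tier-1 ball `ClusterDomainFR ε₀ ε₁ r`, for the perturbation `W_b + W`. [folklore] -/
def AreaLawCentreTubeFR (N d : ℕ) [NeZero N] (β ε₀ ε₁ : ℝ) (r : ℕ) : Prop :=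
  ∃ C c : ℝ, 0 < c ∧ ∀ (L : ℕ) [NeZero L] (Wb W : Perturbation d L N), IsTwistBlind Wb → W ∈ ClusterDomainFR ε₀ ε₁ r →
    ∀ (x : Site d L) (i j : Fin d) (R T : ℕ), i ≠ j → 1 ≤ R → 1 ≤ T → 2 * R ≤ L → 2 * T ≤ L →
      |(Wb + W).expectation (fundamentalRep (Fin N)) β (wilsonLoop (fundamentalRep (Fin N)) x i j R T)| ≤
        C ^ (2 * (R + T)) * Real.exp (-c * (R * T))

/-- A Wilson loop expectation under any member's measure is at most `1` in absolute value. [folklore] -/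
theorem abs_expectation_wilsonLoop_le_one [NeZero L] [NeZero N] (W : Perturbation d L N) (β : ℝ) (x : Site d L) (i j : Fin d)
    (R T : ℕ) : |W.expectation (fundamentalRep (Fin N)) β (wilsonLoop (fundamentalRep (Fin N)) x i j R T)| ≤ 1 := by
  haveI := isProbabilityMeasure_perturbedMeasure W β
  rw [QuasiLocalGaugePerturbation.expectation]
  have h := norm_integral_le_of_norm_le_const (μ := W.perturbedMeasure (fundamentalRep (Fin N)) β)
    (f := wilsonLoop (fundamentalRep (Fin N)) x i j R T) (C := 1) (Filter.Eventually.of_forall fun U => ?_)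
  · simpa using h
  · rw [Real.norm_eq_abs, wilsonLoop_eq_re_loopTrace]
    exact (Complex.abs_re_le_norm _).trans (norm_loopTrace_le_one x i j R T U)

/-- **THE TIER-1 BALL AROUND EVERY CENTRE-BLIND ACTION — area law with one pair of constants for all tori** (`N ≥ 2`,
`2(d−1)N|β| + K(d,r) ε₀ < 1`): `AreaLawCentreTubeFR N d β ε₀ ε₁ r`. [cite: Frohlich1979ZN, Eq. (7)–(9)] -/
theorem areaLawCentreTubeFR [NeZero N] (hN : 2 ≤ N) {β ε₀ : ℝ} (ε₁ : ℝ) (r : ℕ)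
    (hβ : 2 * ((d - 1 : ℕ) : ℝ) * |β| * N + rowConst d r * ε₀ < 1) : AreaLawCentreTubeFR N d β ε₀ ε₁ r := by
  set c₀ := max (2 * ((d - 1 : ℕ) : ℝ) * |β| * N + rowConst d r * ε₀) (1 / 2) with hc₀
  have hc0 : 0 < c₀ := lt_max_of_lt_right (by norm_num)
  have hc1 : c₀ < 1 := max_lt hβ (by norm_num)
  have hcle : 2 * ((d - 1 : ℕ) : ℝ) * |β| * N + rowConst d r * ε₀ ≤ c₀ := le_max_left _ _
  set c := -Real.log c₀ / (((2 * r + 2 : ℕ) : ℝ) * ((2 * r + 1 : ℕ) : ℝ)) with hc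
  have hcpos : 0 < c := div_pos (neg_pos.2 (Real.log_neg hc0 hc1)) (by positivity)
  set C := max 2 (Real.exp (c * ((r : ℝ) + 1) ^ 2)) with hC
  have hC2 : (2 : ℝ) ≤ C := le_max_left _ _
  have hC1 : (1 : ℝ) ≤ C := le_trans (by norm_num) hC2
  refine ⟨C, c, hcpos, fun L _ Wb W hb hW x i j R T hij hR1 hT1 hRL hTL => ?_⟩
  by_cases hL : 2 * r + 2 < L
  · -- large torus: the windowed bound
    have h1 := areaLaw_clusterDomainFR_add_twistBlind hN hL hb hW hcle hc1.le x hij hRL hTL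
    have h2 := windowBound_le_areaLawShape hc0 hc1.le (m := 2 * r + 2) (s := 2 * r + 1) (by omega) (by omega) R T
    refine h1.trans (h2.trans ?_)
    have e : -(-Real.log c₀ / (((2 * r + 2 : ℕ) : ℝ) * ((2 * r + 1 : ℕ) : ℝ))) * ((R : ℝ) * T) = -c * (R * T) := by rw [hc]
    rw [e]
    exact mul_le_mul_of_nonneg_right (pow_le_pow_left₀ (by norm_num) hC2 _) (Real.exp_pos _).le
  · -- small torus: `R, T ≤ r + 1`, the loop is bounded by `1 ≤ C^{2(R+T)} e^{−c RT}`
    have hRr : R ≤ r + 1 := by omega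
    have hTr : T ≤ r + 1 := by omega
    refine (abs_expectation_wilsonLoop_le_one _ β x i j R T).trans ?_
    have hRT : (R : ℝ) * T ≤ ((r : ℝ) + 1) ^ 2 := by
      have h1 : (R : ℝ) ≤ r + 1 := by exact_mod_cast hRr
      have h2 : (T : ℝ) ≤ r + 1 := by exact_mod_cast hTr
      nlinarith [Nat.cast_nonneg (α := ℝ) R, Nat.cast_nonneg (α := ℝ) T]
    have hexp : (1 : ℝ) ≤ Real.exp (c * ((r : ℝ) + 1) ^ 2) * Real.exp (-c * (R * T)) := by
      rw [← Real.exp_add]; exact Real.one_le_exp (by nlinarith)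
    have hCpow : Real.exp (c * ((r : ℝ) + 1) ^ 2) ≤ C ^ (2 * (R + T)) :=
      (le_max_right _ _).trans (le_self_pow₀ hC1 (by omega))
    exact hexp.trans (mul_le_mul_of_nonneg_right hCpow (Real.exp_pos _).le)

/-- **SU(2), `d = 4`, range `1`** (plaquette-range perturbations: e.g. every gauge-invariant plaquette action with per-link oscillation load
`≤ ε₀`, on top of ANY twist-blind action): `6 β_W + K(4,1) ε₀ < 1`, `K(4,1) = 255·4·7⁴ = 2449020`. [folklore] -/
theorem su2_areaLawCentreTubeFR_dim4_range1 {β ε₀ : ℝ} (ε₁ : ℝ) (h : 6 * (2 * |β|) + 2449020 * ε₀ < 1) :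
    AreaLawCentreTubeFR 2 4 β ε₀ ε₁ 1 :=
  areaLawCentreTubeFR (le_refl 2) ε₁ 1 (by rw [rowConst]; push_cast; norm_num; linarith)

end Summit.Ventures.YMGap.RobustBall

end
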